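import Mathlib.Analysis.SpecialFunctions.Log.Basic
import Mathlib.Analysis.SpecialFunctions.Pow.Real
import Mathlib.Analysis.Real.Pi.Bounds
import HarnessLib

/-!
# K2R `RealisedQuasiStaticCellLaw`, line `floquet-bloch`, stub `stub_lowSectorStrong`: scalar inequalities of the S road
# (strongly coupled low sectors) at the replayed cell word (helper; `--supports stmt-AnomalousDissipation-20446`)

Summits-side helper file (pure real arithmetic; no definitions, no named facts). In the good slot of the cubature word
(`|ê_j·ℓ| ≥ √(7/130)‖ℓ‖`, `|m_j·ℓ| ≥ √(7/130)‖ℓ‖‖m_j‖`) a sector with `(δ/10⁴)nν ≤ ‖ℓ‖ ≤ 10⁻⁴n` has in-plane floor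
`F_j ≥ 1/5` and coupling `g_j ≥ δ/10⁸`, so the per-period contraction hypothesis `hcP` of `lowSector_decay_of_rates`
holds at `W′ = (cubatureWord.stretch M).stretch (1/ν)` as soon as `M ≥ 10¹⁸/δ²` (`strong_hcP`); `strong_hcF` is the
free-decay bound `c ≤ π²Mτ_j`.
-/

set_option linter.dupNamespace false

noncomputable section

namespace Summit.AnomalousDissipation.AnomalousDissipation.Theorems.SolenoidalFractalHomogenisation.RealisedQuasiStaticCellLaw

open Real

/-- `0.23 ≤ √(7/130)`. -/
theorem sqrt_seven_div_ge : (23 / 100 : ℝ) ≤ Real.sqrt (7 / 130) := by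
  rw [show (23 / 100 : ℝ) = Real.sqrt ((23 / 100) ^ 2) from (Real.sqrt_sq (by norm_num)).symm]
  exact Real.sqrt_le_sqrt (by norm_num)

/-- **Free-decay bound of the S road**: `c ≤ 1 ≤ 8π²(ν/n²)(n/2)²(Mτ/ν·(1 − 1/2)) = π²Mτ`. -/
theorem strong_hcF {c M τ ν n ρ : ℝ} (hc1 : c ≤ 1) (hM10 : 10 ≤ M) (hτ : 40 ≤ τ) (hν : 0 < ν) (hn : 0 < n)
    (hρ : ρ = 1 / 2) :
    c ≤ 8 * π ^ 2 * (ν / n ^ 2) * (n / 2) ^ 2 * (M * τ / ν * (1 - ρ)) := by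
  subst hρ
  have hπ := Real.pi_gt_three
  have e : 8 * π ^ 2 * (ν / n ^ 2) * (n / 2) ^ 2 * (M * τ / ν * (1 - 1 / 2)) = π ^ 2 * (M * τ) := by
    field_simp
    ring
  rw [e]
  have hMτ : (400 : ℝ) ≤ M * τ := by nlinarith
  have h9 : (9 : ℝ) ≤ π ^ 2 := by nlinarith
  have := mul_le_mul h9 hMτ (by norm_num) (by positivity)
  linarith

/-- **Per-period contraction of the S road** (`hcP` of `lowSector_decay_of_rates` at the cell word, good slot). -/
theorem strong_hcP {c M ν n a Fm bm τ θ xx xK KK δ ρ : ℝ} (hc1 : c ≤ 1) (hδ : 0 < δ) (hδ1 : δ ≤ 1)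
    (hM : 10 ^ 18 / δ ^ 2 ≤ M) (hν : 0 < ν) (hn : 0 < n) (ha0 : 0 < a) (hbig : δ / 10000 * (n * ν) ≤ a)
    (han : 10000 * a ≤ n) (hF1 : 1 ≤ Fm) (hF3 : Fm ≤ 3) (hbm1 : 1 ≤ bm) (hbmF : bm ^ 2 = Fm) (hτ : 40 ≤ τ)
    (hθ : Real.sqrt (7 / 130) * a ≤ θ) (hxx : xx = a ^ 2) (hKK : KK = (n * bm) ^ 2)
    (hxK : Real.sqrt (7 / 130) * (a * (n * bm)) ≤ |xK|) (hρ : ρ = 1 / 2) :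
    Real.log (2 * (5 / 3)) + c ≤
      4 * π ^ 2 * Fm * ν * min 2 (((|xK| - xx) / (Real.sqrt xx * (Real.sqrt xx + Real.sqrt KK))) ^ 2) *
        (θ / (8 * π ^ 2 * Fm * bm * n * ν) / 2) *
        min (θ / (8 * π ^ 2 * Fm * bm * n * ν) / 2) (θ / (8 * π ^ 2 * Fm * bm * n * ν))⁻¹ / 80 *
        (M * τ / ν * (1 - ρ)) := by
  subst hρ
  have hπ := Real.pi_gt_three
  have hπ4 := Real.pi_lt_four
  have hbm2 : bm ≤ 2 := by
    by_contra h
    have h' : 2 < bm := lt_of_not_ge h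
    nlinarith only [hbmF, hF3, h']
  have hbm0 : 0 < bm := by linarith
  have hnb : 0 < n * bm := by positivity
  have hnν : 0 < n * ν := by positivity
  have hM0 : 0 < M := lt_of_lt_of_le (by positivity) hM
  have h23 := sqrt_seven_div_ge
  have hxK' : 23 / 100 * (a * (n * bm)) ≤ |xK| := le_trans (mul_le_mul_of_nonneg_right h23 (by positivity)) hxK
  have hθ' : 23 / 100 * a ≤ θ := le_trans (mul_le_mul_of_nonneg_right h23 ha0.le) hθ
  have hθ0 : 0 < θ := lt_of_lt_of_le (by positivity) hθ'
  -- the in-plane floor `F ≥ 1/5`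
  rw [hxx, hKK, Real.sqrt_sq ha0.le, Real.sqrt_sq hnb.le]
  have hF : 1 / 5 ≤ (|xK| - a ^ 2) / (a * (a + n * bm)) := by
    rw [le_div_iff₀ (by positivity)]
    have h1 : a ≤ n * bm / 10000 := by
      have : (n : ℝ) ≤ n * bm := le_mul_of_one_le_right hn.le hbm1
      linarith only [han, this]
    have h2 := mul_le_mul_of_nonneg_left h1 ha0.le
    have h3 : 0 ≤ a * (n * bm) := by positivity
    nlinarith only [hxK', h2, h3]
  have hm2 : 1 / 25 ≤ min 2 (((|xK| - a ^ 2) / (a * (a + n * bm))) ^ 2) :=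
    le_min (by norm_num) (by nlinarith [hF])
  -- the coupling `g ≥ δ/10⁸`
  obtain ⟨g, hg⟩ : ∃ g : ℝ, θ / (8 * π ^ 2 * Fm * bm * n * ν) = g := ⟨_, rfl⟩
  rw [hg]
  have hgpos : 0 < g := by rw [← hg]; positivity
  have hg0 : δ / 10 ^ 8 ≤ g := by
    rw [← hg, le_div_iff₀ (by positivity)]
    have h1 : 8 * π ^ 2 * Fm * bm ≤ 768 := by
      have : π ^ 2 ≤ 16 := by nlinarith
      have h2 : π ^ 2 * Fm ≤ 16 * 3 := mul_le_mul this hF3 (by linarith) (by norm_num)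
      nlinarith
    have h2 : δ / 10 ^ 8 * (8 * π ^ 2 * Fm * bm * n * ν) = δ * (n * ν) / 10 ^ 8 * (8 * π ^ 2 * Fm * bm) := by ring
    rw [h2]
    have h3 : δ * (n * ν) / 10 ^ 8 * (8 * π ^ 2 * Fm * bm) ≤ δ * (n * ν) / 10 ^ 8 * 768 :=
      mul_le_mul_of_nonneg_left h1 (by positivity)
    have h4 : 0 ≤ δ * (n * ν) := by positivity
    nlinarith only [h3, hθ', hbig, h4]
  have hP : δ ^ 2 / (4 * 10 ^ 16) ≤ g / 2 * min (g / 2) g⁻¹ := by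
    rcases le_total (g / 2) g⁻¹ with h | h
    · rw [min_eq_left h]
      have : (δ / 10 ^ 8) ^ 2 ≤ g ^ 2 := pow_le_pow_left₀ (by positivity) hg0 2
      nlinarith only [this]
    · rw [min_eq_right h, show g / 2 * g⁻¹ = 1 / 2 by field_simp]
      have : δ ^ 2 ≤ 1 := by nlinarith only [hδ, hδ1]
      rw [div_le_iff₀ (by positivity)]
      linarith only [this]
  -- assemble
  have hlog : Real.log (2 * (5 / 3)) ≤ 7 / 3 := (Real.log_le_sub_one_of_pos (by norm_num)).trans (by norm_num)
  have e : 4 * π ^ 2 * Fm * ν * min 2 (((|xK| - a ^ 2) / (a * (a + n * bm))) ^ 2) * (g / 2) * min (g / 2) g⁻¹ / 80 *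
      (M * τ / ν * (1 - 1 / 2)) =
      π ^ 2 * Fm * M * τ / 40 * (min 2 (((|xK| - a ^ 2) / (a * (a + n * bm))) ^ 2) * (g / 2 * min (g / 2) g⁻¹)) := by
    field_simp
    ring
  rw [e]
  have h1 : 1 / 25 * (δ ^ 2 / (4 * 10 ^ 16)) ≤
      min 2 (((|xK| - a ^ 2) / (a * (a + n * bm))) ^ 2) * (g / 2 * min (g / 2) g⁻¹) :=
    mul_le_mul hm2 hP (by positivity) (le_trans (by norm_num) hm2)
  have h2 : 9 * M ≤ π ^ 2 * Fm * M * τ / 40 := by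
    rw [le_div_iff₀ (by norm_num)]
    have h9 : 9 ≤ π ^ 2 := by nlinarith only [hπ]
    have : 9 ≤ π ^ 2 * Fm := by nlinarith only [h9, hF1]
    have h' := mul_le_mul_of_nonneg_right (mul_le_mul this hτ (by norm_num) (by positivity)) hM0.le
    linarith only [h']
  have hMδ : 10 ^ 18 ≤ M * δ ^ 2 := by rwa [div_le_iff₀ (by positivity)] at hM
  have h3 := mul_le_mul h2 h1 (by positivity) (by positivity)
  have h4 : 9 * M * (1 / 25 * (δ ^ 2 / (4 * 10 ^ 16))) = 9 * (M * δ ^ 2) / 10 ^ 18 := by ring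
  rw [h4] at h3
  have h5 : (9 : ℝ) ≤ 9 * (M * δ ^ 2) / 10 ^ 18 := by
    rw [le_div_iff₀ (by positivity)]; linarith only [hMδ]
  linarith only [hlog, hc1, h3, h5]

end Summit.AnomalousDissipation.AnomalousDissipation.Theorems.SolenoidalFractalHomogenisation.RealisedQuasiStaticCellLaw

end
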